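import Summits.QuantumFields.BalabanUV.Beta.GAN24.BornLambdaUndressedRow
import Summits.QuantumFields.BalabanUV.Beta.GAN24.BornBorderLineage

/-!
# `BalabanUV.Beta.GAN24.BornBorderLift` — binder row G-an2-4 / (CONV-C), CT-ROUTE, `gen21/BORNV-PLAN-v0.md` §2 (V-U), PART 1: **THE MIXED-CHANNEL LIFT** —
# the two mixed three-leg pushes of an OFF-DIAGONAL level-`M` family through the (K1b′) response legs `respStep M N′` and the multiplier legs of
# the decimated one-shot resolvent ARE the one-shot third-jet functional `e3OfS N′` of its contour-summed averaging lift (the V-sector twin of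
# `BornLambdaLift.push₃_respStep_eq_e3OfS_borderSum`)

NOT IN PRINT; OUR BOOKKEEPING (row owner `b2b-balaban-gan24-p1`, gen 21; [folklore] identities over tree theorems BY NAME: the owner's g12
`CubicReadoutDecLift.e3K_borderSum` (decimation–lift exchange, ANY local family), leaf-01's four-channel read `SrecLinearPartEq.e3K_eq_neg_sum_push₃` and
`reslot` ∕ `push₃_zero`, `Push3LegTelescope` trilinearity, today's `BornLambdaLift.colH_dec_KInv` ∕ `rowM_dec_KInv`, an4's `decays_dec`).  0 `def`, 0 cited facts,
0 `def … : Prop`, 0 sorry; NO estimate.  HONEST FRAMING (cell contract, verbatim): «discharging `BetaPertH` makes Bałaban's UV stability UNCONDITIONAL — a real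
constructive-QFT result; it is NOT the continuum limit and NOT the Clay problem.»  HONEST DEPENDENCY (verbatim): «continuum YM on T⁴ ⇐ BetaPertH ∧ nine spine
estimates (0/9 proved); BetaPertH ⇐ (D1) ∧ (D4) ∧ CAP+tail; G-an2-4 gates asym, D1 and NE2/3/4.»  Discharges NO slot letter; hB OPEN; NEVER «G-an2-4 closed» as
(CONV-C); NOT D1, NOT `BetaPertH`, NOT continuum, NOT Clay.

## What (generic `d`; `N′ = M·L`)
* §1 `reslot_inl_inl_eq_zero_of` ∕ `reslot_inr_inr_eq_zero_of` (an off-diagonal family has no diagonal channels).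
* §2 **`mixed_push₃_eq_e3OfS_borderSum`**: for every LOCAL OFF-DIAGONAL stencil family `P` on the level-`M` lattice (ff and mm blocks zero),
  `push₃ B (colM D L) B (reslot inl inr P) κ′ u′ − push₃ (rowMM D L) B B (reslot inr inl P) κ′ u′ = e3OfS N′ ((M^{d+2}) • borderSum M P) κ′ u′`,
  `B = respStep M N′`, `D = dec M (KInv N′)` — the undressed one-step image of a V-type (border) source FROM level `M`, read with the response legs and the
  (root-free, undressed) multiplier legs of the decimated one-shot resolvent, IS the one-shot cubic read-out at blocking `N′` of the weight-`M^{d+2}` lift.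
  (The Λ twin has three response legs and weight `(M^{d+2})²`; here two response legs and weight `M^{d+2}`.)
Unit `b2b-balaban-gan24-p1` (row owner G-an2-4, gen 21), 2026-08-21.
-/

noncomputable section

open Finset
open scoped BigOperators
open Literature.MathematicalPhysics.QuantumFieldTheory
open Literature.MathematicalPhysics.QuantumFieldTheory.Balaban1983to89
open Literature.MathematicalPhysics.QuantumFieldTheory.Balaban1983to89.Beta
open ExpKernelCalculus (MKer Decays)
open OneStepResolventKernel (Fib LocStencil KInv decays_KInv)
open OneStepKernelFamily (dec colH KInvStep decays_dec)
open AffineAveraging (box toSite)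
open AveragingHessianKernels (ell)
open AveragingHessianKernelsRooted (vhSAt locStencil_vhSAt)
open Summit.QuantumFields.BalabanUV.Beta.GAN24.StencilSlotVHRoot (vhSAt_inl_inl vhSAt_inr_inr)
open StepJetData (locStencil_smul)
open Summit.QuantumFields.BalabanUV.Beta.HessKerDressedUnits (unitK_apply legScale_inr)
open Summit.QuantumFields.BalabanUV.Beta.GAN24.CombesThomas (sfStep smStep KStepUnit)
open Summit.QuantumFields.BalabanUV.Beta.GAN24.SrecUnits (KStepUnit_eq)
open Summit.QuantumFields.BalabanUV.Beta.GAN24.BornLambdaUndressedRow (e3OfS_smul)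
open BalabanCompositeJets (respStep)
open DecLiftAdjoint (borderSum)
open Summit.QuantumFields.BalabanUV.Beta.GAN24.Push4 (rowM IsFF)
open Summit.QuantumFields.BalabanUV.Beta.GAN24.Push3 (push₃)
open Summit.QuantumFields.BalabanUV.Beta.GAN24.Push3LegTelescope (push₃_smul_left push₃_smul_right push₃_smul_table push₃_neg_left)
open Summit.QuantumFields.BalabanUV.Beta.GAN24.E3UnitSplit (e3OfS)
open Summit.QuantumFields.BalabanUV.Beta.GAN24.ThirdJetKernel (e3K e3OfS_eq_e3K e3K_smul)
open Summit.QuantumFields.BalabanUV.Beta.GAN24.CubicReadoutDecLift (e3K_borderSum)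
open Summit.QuantumFields.BalabanUV.Beta.GAN24.SrecLinearPartEq (colM rowMM colM_apply rowMM_apply reslot reslot_inl_inl e3K_eq_neg_sum_push₃ push₃_zero)
open Summit.QuantumFields.BalabanUV.Beta.GAN24.BornLambdaLift (colH_dec_KInv rowM_dec_KInv)

namespace Summit.QuantumFields.BalabanUV.Beta.GAN24.BornBorderLift

variable {d : ℕ}

/-! ## §1 An off-diagonal family has no diagonal channels -/

/-- [folklore] If the ff block of `P` vanishes, its ff re-slotting is the zero family. -/
theorem reslot_inl_inl_eq_zero_of {P : Fin (d + 1) → (Fin (d + 1) → ℤ) → MKer (d + 1) (Fib d)}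
    (hff : ∀ κ u x z (α β : Fin (d + 1)), P κ u x z (Sum.inl α) (Sum.inl β) = 0) :
    reslot Sum.inl Sum.inl P = fun (_ : Fin (d + 1)) (_ : Fin (d + 1) → ℤ) => (0 : MKer (d + 1) (Fib d)) := by
  funext κ u x z a b
  rcases a with κ₁ | μ
  · rcases b with κ₂ | ν
    · rw [reslot_inl_inl, hff]; rfl
    · rfl
  · cases b <;> rfl

/-- [folklore] If the mm block of `P` vanishes, its mm re-slotting is the zero family. -/
theorem reslot_inr_inr_eq_zero_of {P : Fin (d + 1) → (Fin (d + 1) → ℤ) → MKer (d + 1) (Fib d)}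
    (hmm : ∀ κ u x z (μ ν : Fin (d + 1)), P κ u x z (Sum.inr μ) (Sum.inr ν) = 0) :
    reslot Sum.inr Sum.inr P = fun (_ : Fin (d + 1)) (_ : Fin (d + 1) → ℤ) => (0 : MKer (d + 1) (Fib d)) := by
  funext κ u x z a b
  rcases a with κ₁ | μ
  · rcases b with κ₂ | ν
    · rw [reslot_inl_inl, hmm]; rfl
    · rfl
  · cases b <;> rfl

/-! ## §2 The mixed-channel lift -/

section Lift

variable {M L N' : ℕ} [NeZero M] [NeZero N']

/-- NOT IN PRINT; OUR BOOKKEEPING ([folklore]; (V-U) STEP, generic).  **THE UNDRESSED ONE-STEP IMAGE OF A BORDER SOURCE IS A ONE-SHOT THIRD JET OF ITS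
LIFT**: for every LOCAL OFF-DIAGONAL stencil family `P` on the level-`M` lattice (ff and mm blocks zero) and `N′ = M·L`, with `B = respStep M N′` and
`D = dec M (KInv N′)`,
`push₃ B (colM D L) B (reslot inl inr P) κ′ u′ − push₃ (rowMM D L) B B (reslot inr inl P) κ′ u′ = e3OfS N′ ((M^{d+2}) • borderSum M P) κ′ u′`.
Mechanism: `e3OfS N′ = e3K (KInv N′) N′`; the decimation–lift exchange `e3K K N′ (borderSum M P) = M^{d+2} • e3K (dec M K) L P` (g12, any local `P`); the
four-channel read of `e3K D L P` (leaf-01) in which the two diagonal channels vanish for an off-diagonal `P`; the response legs of `D` are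
`∓(M^{d+2})⁻¹ • B` (`BornLambdaLift` §1) while its multiplier legs `colM D L` ∕ `rowMM D L` stay (root-free mm entries of `KInv N′` at the `M`-images of
`L`-coarse points); trilinearity: `M^{d+2}·M^{d+2}·(M^{−(d+2)})² = 1`, the signs cancel. -/
theorem mixed_push₃_eq_e3OfS_borderSum (hN : N' = M * L) {P : Fin (d + 1) → (Fin (d + 1) → ℤ) → MKer (d + 1) (Fib d)} {Cs δ : ℝ}
    (hP : LocStencil P Cs δ) (hδ : 0 < δ)
    (hff : ∀ κ u x z (α β : Fin (d + 1)), P κ u x z (Sum.inl α) (Sum.inl β) = 0)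
    (hmm : ∀ κ u x z (μ ν : Fin (d + 1)), P κ u x z (Sum.inr μ) (Sum.inr ν) = 0)
    (κ' : Fin (d + 1)) (u' : Fin (d + 1) → ℤ) :
    push₃ (respStep (d := d) M N') (colM (dec M (KInv (N := N') (d := d))) L) (respStep (d := d) M N') (reslot Sum.inl Sum.inr P) κ' u'
      - push₃ (rowMM (dec M (KInv (N := N') (d := d))) L) (respStep (d := d) M N') (respStep (d := d) M N') (reslot Sum.inr Sum.inl P) κ' u'
      = e3OfS N' (fun κ u => (((M : ℝ) ^ (d + 2))) • borderSum M P κ u) κ' u' := by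
  obtain ⟨δK, CK, hδK, hCK, hK⟩ := decays_KInv (N := N') (d := d)
  have hM1 : 1 ≤ M := Nat.one_le_iff_ne_zero.2 (NeZero.ne M)
  have hM : ((M : ℝ) ^ (d + 2)) ≠ 0 := pow_ne_zero _ (by exact_mod_cast NeZero.ne M)
  have hD : Decays (dec M (KInv (N := N') (d := d))) (CK * Real.exp (δK * (4 * (d + 1) * M))) δK := decays_dec hK hCK hδK.le hM1
  symm
  rw [e3OfS_eq_e3K, e3K_smul, e3K_borderSum (L := L) hK hδK hP hδ hN κ' u', e3K_eq_neg_sum_push₃ hD hδK L hP hδ κ' u',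
    reslot_inl_inl_eq_zero_of hff, reslot_inr_inr_eq_zero_of hmm, push₃_zero, push₃_zero, zero_add, add_zero, rowM_dec_KInv hN,
    colH_dec_KInv hN, push₃_neg_left, push₃_smul_left, push₃_smul_table, push₃_smul_right, push₃_smul_table]
  -- the scalars, entrywise: `M^{d+2}·M^{d+2}·(M^{−(d+2)})² = 1`, the signs cancel
  funext x z p q
  simp only [Pi.smul_apply, Pi.neg_apply, Pi.add_apply, Pi.sub_apply, smul_eq_mul]
  field_simp
  ring

end Lift

/-! ## §3 The comb instance: the UNDRESSED one-step image of the V-source is the one-shot third jet of the lifted symmetric border table -/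

section Comb

variable {Lc : ℕ} [NeZero Lc]

/-- [folklore] The multiplier column leg of the unit step resolvent is `s_m²` times that of the decimated one-shot resolvent:
`colM (KStepUnit Lc i) Lc = (smStep d Lc i)² • colM (dec (Lc^i) (KInv (Lc^(i+1)))) Lc` (asym1's `unitK` on the mm block; `KInvStep = dec` by `rfl`). -/
theorem colM_KStepUnit (i : ℕ) :
    colM (KStepUnit (d := d) Lc i) Lc = (smStep d Lc i) ^ 2 • colM (dec (Lc ^ i) (KInv (N := Lc ^ (i + 1)) (d := d))) Lc := by
  funext β z' ν z
  rw [colM_apply, Pi.smul_apply, Pi.smul_apply, Pi.smul_apply, Pi.smul_apply, smul_eq_mul, colM_apply, KStepUnit_eq, unitK_apply,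
    legScale_inr, legScale_inr]
  show smStep d Lc i * KInvStep (d := d) Lc i z ((Lc : ℤ) • z') (Sum.inr ν) (Sum.inr β) * smStep d Lc i = _
  rw [show KInvStep (d := d) Lc i = dec (Lc ^ i) (KInv (N := Lc ^ (i + 1)) (d := d)) from rfl]
  ring

/-- [folklore] The same for the multiplier row leg: `rowMM (KStepUnit Lc i) Lc = (smStep d Lc i)² • rowMM (dec (Lc^i) (KInv (Lc^(i+1)))) Lc`. -/
theorem rowMM_KStepUnit (i : ℕ) :
    rowMM (KStepUnit (d := d) Lc i) Lc = (smStep d Lc i) ^ 2 • rowMM (dec (Lc ^ i) (KInv (N := Lc ^ (i + 1)) (d := d))) Lc := by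
  funext α x' μ x
  rw [rowMM_apply, Pi.smul_apply, Pi.smul_apply, Pi.smul_apply, Pi.smul_apply, smul_eq_mul, rowMM_apply, KStepUnit_eq, unitK_apply,
    legScale_inr, legScale_inr]
  show smStep d Lc i * KInvStep (d := d) Lc i ((Lc : ℤ) • x') x (Sum.inr α) (Sum.inr μ) * smStep d Lc i = _
  rw [show KInvStep (d := d) Lc i = dec (Lc ^ i) (KInv (N := Lc ^ (i + 1)) (d := d)) from rfl]
  ring

/-- NOT IN PRINT; OUR BOOKKEEPING ([folklore]; BORNV-PLAN-v0 (V-1)∕(V-U), one step).  **THE UNDRESSED ONE-STEP IMAGE OF THE COMB V-SOURCE IS THE ONE-SHOT THIRD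
JET OF THE LIFTED SYMMETRIC BORDER TABLE**: with `V = cVH • vhSAt ρ` (the V-source of EVERY member in its own units, leaf-01's `unitS_freshAt_v`),
`R⁰ = respStep (Lc^i) (Lc^(i+1))`, `K̃_i = KStepUnit Lc i` — leaf-01's `BornBorderLineage.unitStepMap_v_eq_two_push₃` with the dressed one-step response
`respStepBm ρ Lc (Lc^i) (Lc^(i+1))` REPLACED BY the undressed `R⁰` —
`(cE·Lc^{2(d+1)}) • (−(push₃ (−R⁰) (colM K̃_i Lc) R⁰ (reslot inl inr V) + push₃ (rowMM K̃_i Lc) R⁰ R⁰ (reslot inr inl V)))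
 = e3OfS (Lc^(i+1)) ((cE·Lc^{2(d+1)}·(smStep d Lc i)²·(Lc^i)^{d+2}) • borderSum (Lc^i) V)` (in-block root; §2 + the unit legs above).  NOTE: the table is an1's
SYMMETRIC `vhSAt ρ` (the literal (E)), NOT the antisymmetrised `mfNeg`-border of `BalabanCompositeJets.Sc` ∕ `SpineRooted.borderIncAt`. -/
theorem undressedStepV_eq_e3OfS_borderSum (hLc : 1 ≤ Lc) {rr : Fin (d + 1) → ℕ} (hrr : rr ∈ box (d + 1) Lc) (cE cVH : ℝ) (i : ℕ)
    (κ' : Fin (d + 1)) (u' : Fin (d + 1) → ℤ) :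
    (cE * (Lc : ℝ) ^ (2 * (d + 1))) •
        -(push₃ (-respStep (d := d) (Lc ^ i) (Lc ^ (i + 1))) (colM (KStepUnit (d := d) Lc i) Lc) (respStep (d := d) (Lc ^ i) (Lc ^ (i + 1)))
              (reslot Sum.inl Sum.inr fun κ u => cVH • vhSAt (toSite rr) d Lc rfl κ u) κ' u'
          + push₃ (rowMM (KStepUnit (d := d) Lc i) Lc) (respStep (d := d) (Lc ^ i) (Lc ^ (i + 1))) (respStep (d := d) (Lc ^ i) (Lc ^ (i + 1)))
              (reslot Sum.inr Sum.inl fun κ u => cVH • vhSAt (toSite rr) d Lc rfl κ u) κ' u')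
      = e3OfS (Lc ^ (i + 1)) (fun κ u => (cE * (Lc : ℝ) ^ (2 * (d + 1)) * (smStep d Lc i) ^ 2 * ((Lc : ℝ) ^ i) ^ (d + 2)) •
          borderSum (Lc ^ i) (fun κ u => cVH • vhSAt (toSite rr) d Lc rfl κ u) κ u) κ' u' := by
  -- the source is local (rate 1) and off-diagonal
  have hS : LocStencil (fun κ u => cVH • vhSAt (toSite rr) d Lc rfl κ u)
      (|cVH| * (3 * (ell (d + 1) Lc : ℝ) ^ 2 * Real.exp (4 * ((d : ℝ) + 1) * Lc * 1))) 1 :=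
    locStencil_smul cVH (locStencil_vhSAt hLc hrr zero_le_one)
  have hff : ∀ κ u x z (α β : Fin (d + 1)), (fun κ u => cVH • vhSAt (toSite rr) d Lc rfl κ u) κ u x z (Sum.inl α) (Sum.inl β) = 0 :=
    fun κ u x z α β => by simp only [Pi.smul_apply, smul_eq_mul, vhSAt_inl_inl, mul_zero]
  have hmm : ∀ κ u x z (μ ν : Fin (d + 1)), (fun κ u => cVH • vhSAt (toSite rr) d Lc rfl κ u) κ u x z (Sum.inr μ) (Sum.inr ν) = 0 :=
    fun κ u x z μ ν => by simp only [Pi.smul_apply, smul_eq_mul, vhSAt_inr_inr, mul_zero]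
  have hN : Lc ^ (i + 1) = Lc ^ i * Lc := pow_succ Lc i
  have key := mixed_push₃_eq_e3OfS_borderSum (M := Lc ^ i) (L := Lc) hN hS one_pos hff hmm κ' u'
  rw [colM_KStepUnit, rowMM_KStepUnit, push₃_neg_left, push₃_smul_right, push₃_smul_left, Nat.cast_pow] at *
  rw [show (fun κ u => (cE * (Lc : ℝ) ^ (2 * (d + 1)) * smStep d Lc i ^ 2 * ((Lc : ℝ) ^ i) ^ (d + 2)) •
        borderSum (Lc ^ i) (fun κ u => cVH • vhSAt (toSite rr) d Lc rfl κ u) κ u)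
      = fun κ u => (cE * (Lc : ℝ) ^ (2 * (d + 1)) * smStep d Lc i ^ 2) •
        (fun κ u => (((Lc : ℝ) ^ i) ^ (d + 2)) • borderSum (Lc ^ i) (fun κ u => cVH • vhSAt (toSite rr) d Lc rfl κ u) κ u) κ u by
      funext κ u; rw [smul_smul], e3OfS_smul, ← key, neg_add, neg_neg, smul_sub, smul_add, smul_neg, smul_smul, smul_smul, sub_eq_add_neg]

end Comb

end Summit.QuantumFields.BalabanUV.Beta.GAN24.BornBorderLift

end
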